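import Mathlib
import HarnessLib
import Summits.ResolutionOfSingularities.ResolutionOfSingularities.Theorems.WildQuotientsWildQuotientResolutionJordanThreeTwoX0ChartRing
import Summits.ResolutionOfSingularities.ResolutionOfSingularities.Theorems.WildQuotientsWildQuotientResolutionJordanThreeTwoChartAWeightZero
import Summits.ResolutionOfSingularities.ResolutionOfSingularities.Theorems.WildQuotientsWildQuotientResolutionJordanThreeTwoChartASeam
import Summits.ResolutionOfSingularities.ResolutionOfSingularities.Theorems.WildQuotientsWildQuotientResolutionJordanFiveChartW2RangeConversion
import Summits.ResolutionOfSingularities.ResolutionOfSingularities.Theorems.WildQuotientsWildQuotientResolutionHalf111Blowup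
import Summits.ResolutionOfSingularities.ResolutionOfSingularities.Theorems.WildQuotientsWildQuotientResolutionJordanFourConeVertexIdeals

/-!
# N4a cone column: the RING SIDE on the `μ₂`-vertex chart ring `B₀ = (k[x][It])_{(x_a t)}`
(crux stmt-ResolutionOfSingularities-15640 `WildQuotients.WildQuotientResolution`, line `Sketch`;
chain w45c post-V5 width target N4a `JordanThreeTwo.jordanThreeTwo_hasResolution`
(res-L1-w45c-plan-1 NO OBJECTION 2026-08-27T14:24:34Z / 15:17:58Z); the `J₃ ⊕ J₂` twin of
res-L1-w45c-stub-2's `JordanFive.chart0_seamFixed_iff` (p540516) composed with the X0 model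
`JordanThreeTwo.exists_ringBrick_X0_model` (p541527) and (A1) `exists_ringEquiv_chartRingA_weightZero`
(p547722). [OURS · L1 W4.5c] — assembly of landed decls; NOT a statement of any manuscript.
Prover res-L1-w45c-stub-2. Def-free.)

SETTING. `I = (x_a, x_b², x_bx_d, x_d²)` (spelling of record), `B₀ = (k[x][It])_{(x_a t)}` the chart
ring of the cone chart `V[x_a]` of `Bl_I 𝔸ⁿ` in the letters of res-D-pv-033's seam
`JordanThreeTwo.exists_sectionsEquiv_chart_a_appLE` (p546684): section `s₀ = x_a·t`
(`reesT (X a) (X_a_mem_I4 …)`), base map `F ↦ F/1` (`reesChartBase`), graded family `φ` with the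
coefficient law `hφ` and the powers clause `hP`.

* `chartA_fixed_iff_of_intertwines` / `chartA_seamFixed_iff` — (B): for `eE : B₀ ≃+* ↥E` with
  `eE (F/1) = ψ₀ F` (`ψ₀` the root substitution `x_a ↦ u², x_b ↦ ub, x_d ↦ uf`) and the root-chart
  automorphism `σ_U` with `ψ₀ ∘ σ = σ_U ∘ ψ₀`: `σ_U (eE y) = eE y ↔ ∀ g, map (φ g) _ y = y`
  (res-L1-w45c-lead-1's generic `BlowupExit.map_away_fixed_iff_of_intertwines`, degree `1`,
  coefficient `x_a`, `σ x_a = x_a`).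
* **`exists_ringBrick_chartA`** — THE RING SIDE (the hypothesis `H` of `JordanFour.ringBrick_transport`,
  p519150, at `base := (· /1)`, `P y := ∀ g, map (φ g) _ y = y`, `tP := x_a`, `gen j := g_j`
  (`j ≠ 0`), `F := {x_a, x_b, x_d}`): for all ratio families `t` with `(x_a/1)·t_j = g_j/1` there are
  `R₀ := k[Y] ⧸ ker (Half111.presentation k n a b d)`, its vertex ideal `J₀ = ⟨Half111.gens⟩`
  (radical, `Half111.span_gens_isRadical`; `Bl_{J₀}` regular, `Half111.blowup_regular` p500272) and
  an injective `ψC : R₀ → B₀` onto the `φ`-fixed part with `√(ψC⁻¹⟨x_a/1, x_b/1, x_d/1, t_j⟩) = J₀`.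
-/

-- single-problem summit: the doubled namespace component `ResolutionOfSingularities` is forced
set_option linter.dupNamespace false

noncomputable section

open MvPolynomial Polynomial HomogeneousLocalization Literature.AlgebraicGeometry.Resolution

namespace Summit.ResolutionOfSingularities.ResolutionOfSingularities.Theorems.WildQuotientResolution.JordanThreeTwo

variable (k : Type) [Field k] (n : ℕ) (a b c d e : Fin n)

/-- The generator vector of record (local shorthand). -/
local notation3 "g4" => (![X a, X b ^ 2, X b * X d, X d ^ 2] : Fin 4 → MvPolynomial (Fin n) k)
/-- The centre `I = (x_a, x_b², x_bx_d, x_d²)` (local shorthand). -/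
local notation3 "I4" => Ideal.span (Set.range g4)
/-- The chart-`a` section `s₀ = x_a·t` (local shorthand, res-D-pv-033's letters). -/
local notation3 "s₀" => (reesT (X a : MvPolynomial (Fin n) k) (X_a_mem_I4 k n a b d))
/-- The chart ring `B₀ = (k[x][It])_{(x_a t)}` (local shorthand). -/
local notation3 "B₀" => HomogeneousLocalization.Away (reesGrading I4) s₀
/-- The base map `F ↦ F/1` (local shorthand). -/
local notation3 "base₀" => (reesChartBase (X a : MvPolynomial (Fin n) k) (X_a_mem_I4 k n a b d))
/-- The root substitution `ψ₀` of the `μ₂`-vertex chart (res-L1-w45c-stub-2's `r₃₂`, verbatim). -/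
local notation3 "r₃₂" => (fun i : Fin n => if i = a then X a ^ 2 else if i = b then X a * X b
    else if i = d then X a * X d else (X i : MvPolynomial (Fin n) k))

/-- **(B), ring-model form** on `B₀`: for the seam's graded family `φ` and ANY injective ring model
`e' : B₀ → U` with `e' (x_a/1)` a non-zero-divisor and a ring map `Σ : U → U` with
`Σ (e' (F/1)) = e' ((σ F)/1)` (`σ x_a = x_a`):
`(∀ g, HomogeneousLocalization.map (φ g) _ y = y) ↔ Σ (e' y) = e' y`.
[OURS · L1 W4.5c] [folklore; assembly of landed decls] -/
theorem chartA_fixed_iff_of_intertwines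
    (σ : MvPolynomial (Fin n) k ≃ₐ[k] MvPolynomial (Fin n) k) [Finite ↥(Subgroup.zpowers σ)]
    (ha : σ (X a) = X a)
    (φ : ↥(Subgroup.zpowers σ) → (reesGrading I4 →+*ᵍ reesGrading I4))
    (hφ : ∀ (g : ↥(Subgroup.zpowers σ)) x, ((φ g x : reesAlgebra I4) : (MvPolynomial (Fin n) k)[X]) =
      (x : (MvPolynomial (Fin n) k)[X]).map ((MulSemiringAction.toRingEquiv
        (↥(Subgroup.zpowers σ)) (MvPolynomial (Fin n) k) g⁻¹ : _ ≃+* _) : _ →+* _))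
    (hP : ∀ g, Submonoid.powers s₀ ≤ (Submonoid.powers s₀).comap (φ g))
    {U : Type*} [CommRing U] (e' : B₀ →+* U) (he' : Function.Injective e')
    (hnzd : e' (base₀ (X a)) ∈ nonZeroDivisors U)
    (Sg : U →+* U) (hSg : ∀ F, Sg (e' (base₀ F)) = e' (base₀ (σ F))) (y : B₀) :
    (∀ g, HomogeneousLocalization.map (φ g) (hP g) y = y) ↔ Sg (e' y) = e' y :=
  BlowupExit.map_away_fixed_iff_of_intertwines σ s₀ (reesT_mem _ _) _ (coe_reesT _ _) ha φ hφ hP e'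
    he' hnzd Sg hSg y

/-- **(B) `chartA_seamFixed_iff`**: for `eE : B₀ ≃+* ↥E` onto a subalgebra `E ⊆ k[x]` with
`eE (F/1) = ψ₀ F` and a root-chart automorphism `σ_U` with `ψ₀ ∘ σ = σ_U ∘ ψ₀` (`σ x_a = x_a`):
`σ_U (eE y) = eE y ↔ ∀ g, HomogeneousLocalization.map (φ g) (hP g) y = y`. [OURS · L1 W4.5c]
[folklore; assembly of landed decls] -/
theorem chartA_seamFixed_iff
    (σ : MvPolynomial (Fin n) k ≃ₐ[k] MvPolynomial (Fin n) k) [Finite ↥(Subgroup.zpowers σ)]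
    (ha : σ (X a) = X a)
    (φ : ↥(Subgroup.zpowers σ) → (reesGrading I4 →+*ᵍ reesGrading I4))
    (hφ : ∀ (g : ↥(Subgroup.zpowers σ)) x, ((φ g x : reesAlgebra I4) : (MvPolynomial (Fin n) k)[X]) =
      (x : (MvPolynomial (Fin n) k)[X]).map ((MulSemiringAction.toRingEquiv
        (↥(Subgroup.zpowers σ)) (MvPolynomial (Fin n) k) g⁻¹ : _ ≃+* _) : _ →+* _))
    (hP : ∀ g, Submonoid.powers s₀ ≤ (Submonoid.powers s₀).comap (φ g))
    (E : Subalgebra k (MvPolynomial (Fin n) k)) (eE : B₀ ≃+* ↥E)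
    (hbase : ∀ F, ((eE (base₀ F) : ↥E) : MvPolynomial (Fin n) k) = MvPolynomial.aeval r₃₂ F)
    (σU : MvPolynomial (Fin n) k ≃ₐ[k] MvPolynomial (Fin n) k)
    (hσU : (MvPolynomial.aeval r₃₂).comp (σ : MvPolynomial (Fin n) k →ₐ[k] MvPolynomial (Fin n) k) =
      (σU : MvPolynomial (Fin n) k →ₐ[k] MvPolynomial (Fin n) k).comp (MvPolynomial.aeval r₃₂))
    (y : B₀) :
    σU ((eE y : ↥E) : MvPolynomial (Fin n) k) = ((eE y : ↥E) : MvPolynomial (Fin n) k) ↔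
      ∀ g, HomogeneousLocalization.map (φ g) (hP g) y = y := by
  let e' : B₀ →+* MvPolynomial (Fin n) k := E.val.toRingHom.comp eE.toRingHom
  have he' : ∀ y, e' y = ((eE y : ↥E) : MvPolynomial (Fin n) k) := fun _ => rfl
  have hinj : Function.Injective e' := Subtype.val_injective.comp eE.injective
  have hroot : ∀ F, MvPolynomial.aeval r₃₂ (σ F) = σU (MvPolynomial.aeval r₃₂ F) := fun F => by
    have h := congrArg (fun φ : MvPolynomial (Fin n) k →ₐ[k] MvPolynomial (Fin n) k => φ F) hσU
    simpa only [AlgHom.comp_apply, AlgEquiv.coe_toAlgHom] using h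
  have hnzd : e' (base₀ (X a)) ∈ nonZeroDivisors (MvPolynomial (Fin n) k) := by
    refine mem_nonZeroDivisors_of_ne_zero ?_
    rw [he', hbase, root32_X_a k n a b d]
    exact pow_ne_zero _ (X_ne_zero a)
  have h := chartA_fixed_iff_of_intertwines k n a b d σ ha φ hφ hP e' hinj hnzd
    (σU : MvPolynomial (Fin n) k →+* MvPolynomial (Fin n) k)
    (fun F => show σU (e' (base₀ F)) = e' (base₀ (σ F)) by rw [he', he', hbase, hbase, hroot]) y
  rw [he'] at h
  exact h.symm

set_option maxHeartbeats 1600000 in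
/-- **THE RING SIDE on the `μ₂`-vertex chart** (the hypothesis `H` of `JordanFour.ringBrick_transport`
at `base := (·/1)`, `P y := ∀ g, map (φ g) _ y = y`, `tP := x_a`, `gen j := g_j` (`j ≠ 0`),
`F := {x_a, x_b, x_d}`): see the module docstring. `p` prime, `3 ≤ p = char k`.
[OURS · L1 W4.5c] [folklore; assembly of landed decls] -/
theorem exists_ringBrick_chartA (p : ℕ) (hp : p.Prime) (hp3 : 3 ≤ p) [CharP k p]
    (σ : MvPolynomial (Fin n) k ≃ₐ[k] MvPolynomial (Fin n) k) [Finite ↥(Subgroup.zpowers σ)]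
    (hab : a ≠ b) (hac : a ≠ c) (had : a ≠ d) (hae : a ≠ e) (hbc : b ≠ c) (hbd : b ≠ d)
    (hbe : b ≠ e) (hcd : c ≠ d) (hce : c ≠ e) (hde : d ≠ e)
    (hb : σ (X b) = X b + X a) (hc : σ (X c) = X c + X b) (he : σ (X e) = X e + X d)
    (hσ : ∀ i, i ≠ b → i ≠ c → i ≠ e → σ (X i) = X i)
    (φ : ↥(Subgroup.zpowers σ) → (reesGrading I4 →+*ᵍ reesGrading I4))
    (hφ : ∀ (g : ↥(Subgroup.zpowers σ)) x, ((φ g x : reesAlgebra I4) : (MvPolynomial (Fin n) k)[X]) =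
      (x : (MvPolynomial (Fin n) k)[X]).map ((MulSemiringAction.toRingEquiv
        (↥(Subgroup.zpowers σ)) (MvPolynomial (Fin n) k) g⁻¹ : _ ≃+* _) : _ →+* _))
    (hP : ∀ g, Submonoid.powers s₀ ≤ (Submonoid.powers s₀).comap (φ g))
    (t : {j : Fin 4 // j ≠ 0} → B₀) (ht : ∀ j, base₀ (X a) * t j = base₀ (g4 j.1)) :
    ∃ (R₀ : Type) (_ : CommRing R₀) (J₀ : Ideal R₀) (ψC : R₀ →+* B₀), Function.Injective ψC ∧
      (∀ y : B₀, y ∈ Set.range ψC ↔ ∀ g, HomogeneousLocalization.map (φ g) (hP g) y = y) ∧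
      J₀.IsRadical ∧ Scheme.IsRegular (affineBlowup J₀) ∧
      ((Ideal.span (base₀ '' {X a, X b, X d} ∪ Set.range t)).comap ψC).radical = J₀ := by
  classical
  have ha : σ (X a) = X a := hσ a hab hac hae
  -- the `μ₂`-weight and its weight-`0` model `E`
  let w₂ : Fin n → ZMod 2 := fun i => if i = a then 1 else if i = b then 1 else if i = d then 1 else 0
  have hw₂a : w₂ a = 1 := by simp [w₂]
  have hw₂b : w₂ b = 1 := by simp [w₂]
  have hw₂d : w₂ d = 1 := by simp [w₂]
  have hw₂0 : ∀ i, i ≠ a → i ≠ b → i ≠ d → w₂ i = 0 := fun i h1 h2 h3 => by simp [w₂, h1, h2, h3]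
  let E : Subalgebra k (MvPolynomial (Fin n) k) := Algebra.adjoin k (JordanFour.evenGens k n a b d)
  have hE : ∀ f, f ∈ E ↔ IsWeightedHomogeneous w₂ f 0 :=
    fun f => JordanFour.mem_adjoin_evenGens_iff k n a b d hab had hbd w₂ hw₂a hw₂b hw₂d hw₂0 f
  -- (A1): `B₀ ≃+* E`
  obtain ⟨eE, hbase, -⟩ :
      ∃ eE : B₀ ≃+* ↥E, (∀ F : MvPolynomial (Fin n) k,
        ((eE (base₀ F) : ↥E) : MvPolynomial (Fin n) k) = aeval r₃₂ F) ∧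
        ∀ j : Fin 4, ((eE (chartGen g4 0 j) : ↥E) : MvPolynomial (Fin n) k) =
          (![1, X b ^ 2, X b * X d, X d ^ 2] : Fin 4 → MvPolynomial (Fin n) k) j :=
    exists_ringEquiv_chartRingA_weightZero k n hab had hbd w₂ hw₂a hw₂b hw₂d hw₂0 E hE
  -- the root-chart automorphism and the intertwining
  obtain ⟨σU, hUb, hUc, hUe, hσU⟩ :=
    exists_rootChart32Equiv k n a b c d e hab hac hae hbc hbd hbe hcd hce hde
  have hinter := aeval_root32_comp_eq k n a b c d e hab hac had hae hbc hbd hbe hcd hde σ σU hb hc he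
    hσ hUb hUc hUe hσU
  -- R3: the X0 model
  obtain ⟨ψC, hψinj, hψrange, hψrad⟩ := exists_ringBrick_X0_model k n a b c d e p hab hac had hae hbc
    hbd hbe hcd hce hde hp hp3 σU hUb hUc hUe hσU w₂ hw₂a hw₂b hw₂d hw₂0 E hE base₀ eE hbase t ht
  refine ⟨_, inferInstance, _, ψC, hψinj, fun y => ?_, Half111.span_gens_isRadical k n a b d,
    (Half111.blowup_regular k n a b d hab hbd had).1, hψrad⟩
  -- range: `φ`-fixed ↔ `σ_U`-fixed through `eE` ((B))
  have key := (hψrange y).trans (chartA_seamFixed_iff k n a b d σ ha φ hφ hP E eE hbase σU hinter y)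
  exact ⟨fun ⟨x, hx⟩ => key.mp (RingHom.mem_range.mpr ⟨x, hx⟩),
    fun h => let ⟨x, hx⟩ := RingHom.mem_range.mp (key.mpr h); ⟨x, hx⟩⟩

end Summit.ResolutionOfSingularities.ResolutionOfSingularities.Theorems.WildQuotientResolution.JordanThreeTwo

end
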